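import Summits.ResolutionOfSingularities.ResolutionOfSingularities.Theses.PAlteration
import Literature.AlgebraicGeometry.Resolution.NormalizationInExtension
import Literature.AlgebraicGeometry.Motives.FunctionFieldOver
import Summits.ResolutionOfSingularities.ResolutionOfSingularities.Theorems.PAlterationPicoverFunctionFieldNormalizationIn
import Summits.ResolutionOfSingularities.ResolutionOfSingularities.Theorems.PAlterationPicoverFunctionFieldRadicial
import Summits.ResolutionOfSingularities.ResolutionOfSingularities.Theorems.PAlterationPicoverOfNormalizationIn
import Summits.ResolutionOfSingularities.ResolutionOfSingularities.Theorems.PAlterationPicoverPTower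
import Summits.ResolutionOfSingularities.ResolutionOfSingularities.Theorems.PAlterationPicoverBaseCase
import Summits.ResolutionOfSingularities.ResolutionOfSingularities.Theorems.PAlterationPicoverTowerTransport
import Summits.ResolutionOfSingularities.ResolutionOfSingularities.Theorems.PAlterationPicoverDegPDimLeThree
import Summits.ResolutionOfSingularities.ResolutionOfSingularities.Theorems.PAlterationPicoverKernelReduction
import Literature.AlgebraicGeometry.Resolution.SurfaceResolutionSigmaMaxElimination

/-!
# Crux `Picover` (stmt-ResolutionOfSingularities-0554) — line `degree-p-tower` (lead skeleton, reshaped 2026-08-17)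

The crux: for every prime `p`, field `k` of characteristic `p`, regular integral separated
finite-type `k`-scheme `Y` and finite, universally injective, surjective `g : X → Y` with `X`
integral, `Scheme.HasResolution X`.

Line (Temkin 2013 = arXiv:0804.1554v3, Rem. 1.3.5 (ii): "proceeding inductively"): the
function field extension `K(X)/K(Y)` is finite purely inseparable, of degree `p^n`; filter it by
intermediate fields in steps of degree `p`; the normalization of `Y` in each layer has a resolution
by induction, the inductive step being the RESIDUE `stub_picoverDegP` (normalization of a regular
variety in a degree-`p` purely inseparable extension of its function field — the global form of
the rank-5 local model `t^p = f`), transported along the previous resolution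
(`stub_towerTransport`); finally `X` is reached from the normalization of `Y` in `K(X)` by the
finite birational comparison map (`stub_ofNormalizationIn`).

Stubs (state 2026-08-16T09:40Z: SIX of seven landed — p89459 p89415 p89678 p89365 p89392 p90763 — and
imported below; the only `sorry` left is the RESIDUE `stub_picoverDegP`; its dim ≤ 3 slice modulo
`CossartPiltant2019` is landed as `Picover.DegPDimLeThree.picoverDegP_of_dim_le_three`, p90256):
* `stub_functionField_normalizationIn` — `K(Y^L) ≅ L` over `K(Y)` (foundational glue).
* `stub_functionFieldRadicial` — universally injective + dominant ⟹ `K(X)/K(Y)` purely inseparable.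
* `stub_ofNormalizationIn` — `HasResolution (Y^{K(X)}) → HasResolution X`.
* `stub_pTower` — a finite purely inseparable extension `≠` the base has an intermediate field of
  index `p`.
* `stub_baseCase` — degree `1`: `Y^L ≅ Y` is regular.
* `stub_towerTransport` — the inductive step modulo the residue.
* `stub_picoverDegP` — THE RESIDUE (research content; open in dimension `≥ 4`).
`Picover_of` composes them into the crux BY NAME.

RESHAPE (lead a3, 2026-08-17, after the stub plan `Cruxes/Picover/STUB-PLAN-stub_picoverDegP.md`
and its landed frame `Theorems/PAlterationPicoverLocalBlowups.lean` (p133227),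
`Theorems/PAlterationPicoverKernelReduction.lean` (p133544)): `stub_picoverDegP` is now a THEOREM,
obtained in one call from `KernelReduction.stub_picoverDegP_of_facts_and_kernel` (Temkin's
localisation of desingularization in blow-up form, per scheme, with the local hypothesis at
points of local dimension `≤ 3` discharged from printed theorems). The registered stubs are now:
* four NAMED-FACT stubs (printed theorems, each VERBATIM an existing `Literature` named fact —
  not research, no stub-worker is to be seated on them; they are discharged when the fact's
  `_holds` theorem lands, debt queue): `stub_cossartPiltant2019General` (CP 2019 Thm. 1.1),
  `stub_cossartPiltant2019Principalization` (CP 2019 Prop. 4.4),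
  `stub_cossartJannsenSaito2020SigmaMaxElimination` (CJS 2020 Def. 6.15/Thm. 6.28) and
  `stub_cossartJannsenSaito2020Corollary618` (CJS 2020 Cor. 6.18) — the last two give CJS 2020
  Thm. 1.2 in its printed blow-up-sequence shape (`CossartJannsenSaito2020General_holds_of`);
* ONE research stub, the KERNEL `stub_picoverKernel`: Temkin's local hypothesis at the singular
  points `x` of local dimension `≥ 4` of `W^L` — every blow-up of `Spec 𝒪_{W^L,x}` singular only
  over `x` admits a `Sing`-supported blow-up with regular source (Cossart–Piltant's "test case"
  at `n ≥ 4`; open). It is implied by Temkin-strong resolution of characteristic-`p` varieties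
  (`ResolutionOver (Spec k)` for all fields `k` of characteristic `p`; support file
  `Theorems/PAlterationPicoverKernelHonesty.lean`), not known to follow from the weak summit.
-/

noncomputable section

set_option linter.dupNamespace false

open CategoryTheory AlgebraicGeometry TopologicalSpace
open Literature.AlgebraicGeometry.Resolution Literature.AlgebraicGeometry.Motives

namespace Summit.ResolutionOfSingularities.ResolutionOfSingularities.Cruxes.Picover.DegreePTower

/-! ## Stubs -/

/-- PROVED (was stub; landed p89459). **The function field of the normalization of `W` in `L` is `L`**,
compatibly with `K(W) → L`: for an integral scheme `W` and a finite extension `L` of `K(W)` there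
is a ring isomorphism `e : K(W^L) ≃ L` with `e ∘ ι^♯ = (K(W) → L)`, where `ι : W^L → W` is the
normalization morphism and `ι^♯` the induced map of function fields. (Liu 2002, 4.1.25;
`W^L` is the relative normalization of `W` in `Spec L`.) -/
theorem stub_functionField_normalizationIn : ∀ (W : Scheme.{0}) [IsIntegral W] (L : Type) [Field L] [Algebra W.functionField L] [FiniteDimensional W.functionField L], ∃ e : (normalizationIn W L).functionField ≃+* L, e.toRingHom.comp (RatFn.functionFieldMap (normalizationInι W L)) = algebraMap W.functionField L :=
  Summit.ResolutionOfSingularities.ResolutionOfSingularities.Theorems.Picover.FunctionFieldNormalizationIn.stub_functionField_normalizationIn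

/-- PROVED (was stub; landed p89415). **A universally injective dominant morphism of integral schemes induces a
purely inseparable extension of function fields** (Stacks 01S2/01S4: universally injective iff
injective with purely inseparable residue field extensions; at the generic points the residue
fields are the function fields). -/
theorem stub_functionFieldRadicial : ∀ (X Y : Scheme.{0}) [IsIntegral X] [IsIntegral Y] (g : X ⟶ Y) [UniversallyInjective g] [IsDominant g], IsPurelyInseparable Y.functionField (FunctionFieldOver g) :=
  Summit.ResolutionOfSingularities.ResolutionOfSingularities.Theorems.Picover.FunctionFieldRadicial.stub_functionFieldRadicial

/-- PROVED (was stub; landed p89678). **From the normalization of `Y` in `K(X)` to `X`.** For `g : X → Y` finite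
dominant between integral schemes, `Y` locally of finite type over a field: if the normalization
`Y^{K(X)}` of `Y` in `K(X)` has a resolution then so has `X` — the comparison map
`Y^{K(X)} → X` (universal property of relative normalization applied to `Spec K(X) → X → Y`) is
finite and birational (an isomorphism over the normal locus of `X`, which is a dense open since
`X` is of finite type over a field). Takes the function-field identification of
`stub_functionField_normalizationIn` for `(Y, K(X))` as a hypothesis. -/
theorem stub_ofNormalizationIn : ∀ (k : Type) [Field k] (X Y : Scheme.{0}) [IsIntegral X] [IsIntegral Y] (f : Y ⟶ Spec (.of k)) [LocallyOfFiniteType f] (g : X ⟶ Y) [IsFinite g] [IsDominant g], (∃ e : (normalizationIn Y (FunctionFieldOver g)).functionField ≃+* FunctionFieldOver g, e.toRingHom.comp (RatFn.functionFieldMap (normalizationInι Y (FunctionFieldOver g))) = algebraMap Y.functionField (FunctionFieldOver g)) → Scheme.HasResolution (normalizationIn Y (FunctionFieldOver g)) → Scheme.HasResolution X :=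
  Summit.ResolutionOfSingularities.ResolutionOfSingularities.Theorems.Picover.OfNormalizationIn.stub_ofNormalizationIn

/-- PROVED (was stub; landed p89365). **A finite purely inseparable extension `L ≠ K` has an
intermediate field of index `p`**: pick `x ∉ K`, `minpoly = X^{p^m} − a`, pass to `K(x^{p^{m-1}})`
(degree `p`) and induct on `[L : K]`. -/
theorem stub_pTower : ∀ (p : ℕ) [Fact p.Prime] (K L : Type) [Field K] [Field L] [Algebra K L] [CharP K p] [FiniteDimensional K L] [IsPurelyInseparable K L], Module.finrank K L ≠ 1 → ∃ M : IntermediateField K L, Module.finrank M L = p :=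
  Summit.ResolutionOfSingularities.ResolutionOfSingularities.Theorems.Picover.PTower.stub_pTower

/-- PROVED (was stub; landed p89392). **Degree one.** If `W` is regular (hence normal) and `[L : K(W)] = 1` then the
normalization `W^L → W` is an integral dominant morphism of integral schemes which is an
isomorphism on function fields, hence an isomorphism (`isIso_morphismRestrict_of_isIntegralHom_of_normal`
over `V = ⊤`), so `W^L` is regular and is its own resolution. Takes the function-field
identification for `(W, L)` as a hypothesis. -/
theorem stub_baseCase : ∀ (W : Scheme.{0}) [IsIntegral W] (L : Type) [Field L] [Algebra W.functionField L] [FiniteDimensional W.functionField L], (∃ e : (normalizationIn W L).functionField ≃+* L, e.toRingHom.comp (RatFn.functionFieldMap (normalizationInι W L)) = algebraMap W.functionField L) → Scheme.IsRegular W → Module.finrank W.functionField L = 1 → Scheme.HasResolution (normalizationIn W L) :=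
  Summit.ResolutionOfSingularities.ResolutionOfSingularities.Theorems.Picover.BaseCase.stub_baseCase

/-- PROVED (was stub; landed p90763). The inductive step modulo the residue. **Tower transport.** Fix `p`, `k`.
Assume the function-field identification (first hypothesis, for all `W`, `L`) and the degree-`p`
residue at `(p, k)` (second hypothesis). Let `W` be an integral separated finite-type `k`-scheme,
`L/K(W)` finite, `M` an intermediate field with `L/M` purely inseparable of degree `p`, and suppose
`W^M` has a resolution `ρ : W' → W^M`. Then `W^L` has a resolution: `W'` is regular, integral,
separated of finite type over `k` with `K(W') ≅ M`, so the residue gives a resolution of `W'^L`;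
and the comparison `W'^L → W^L` (relative normalization mapped into `W^L ×_W W'`, then projected)
is proper and birational (integral over the dense open of `W^L` above the isomorphism locus of
`ρ`, an isomorphism on function fields, `W^L` normal). -/
theorem stub_towerTransport : ∀ (p : ℕ) [Fact p.Prime] (k : Type) [Field k] [CharP k p], (∀ (W : Scheme.{0}) [IsIntegral W] (L : Type) [Field L] [Algebra W.functionField L] [FiniteDimensional W.functionField L], ∃ e : (normalizationIn W L).functionField ≃+* L, e.toRingHom.comp (RatFn.functionFieldMap (normalizationInι W L)) = algebraMap W.functionField L) → (∀ (W : Scheme.{0}) [IsIntegral W] (f : W ⟶ Spec (.of k)) (L : Type) [Field L] [Algebra W.functionField L], IsSeparated f → LocallyOfFiniteType f → QuasiCompact f → Scheme.IsRegular W → IsPurelyInseparable W.functionField L → Module.finrank W.functionField L = p → Scheme.HasResolution (normalizationIn W L)) → ∀ (W : Scheme.{0}) [IsIntegral W] (f : W ⟶ Spec (.of k)) [IsSeparated f] [LocallyOfFiniteType f] [QuasiCompact f] (L : Type) [Field L] [Algebra W.functionField L] [FiniteDimensional W.functionField L] (M : IntermediateField W.functionField L), IsPurelyInseparable M L → Module.finrank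 M L = p → Scheme.HasResolution (normalizationIn W M) → Scheme.HasResolution (normalizationIn W L) :=
  Summit.ResolutionOfSingularities.ResolutionOfSingularities.Theorems.Picover.TowerTransport.stub_towerTransport

/-- STUB (NAMED FACT, not research — verbatim the `Literature` named fact
`Literature.AlgebraicGeometry.Resolution.CossartPiltant2019General`; discharged when its `_holds`
theorem lands; no stub-worker). **Cossart–Piltant 2019, Thm. 1.1 (i)+(ii)**: every reduced
separated Noetherian quasi-excellent scheme of dimension `≤ 3` has a resolution which is an
isomorphism over the open `Reg X`. [cite: CossartPiltant2019, Thm. 1.1] -/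
theorem stub_cossartPiltant2019General : CossartPiltant2019General.{0} := by
  sorry

/-- STUB (NAMED FACT, not research — verbatim the `Literature` named fact
`Literature.AlgebraicGeometry.Resolution.CossartPiltant2019Principalization`; discharged when its
`_holds` theorem lands; no stub-worker). **Cossart–Piltant 2019, Prop. 4.4**: principalization
of non-zero ideal sheaves on regular excellent integral threefolds by finitely many blow-ups along
regular centres inside the non-principal locus. [cite: CossartPiltant2019, Prop. 4.4] -/
theorem stub_cossartPiltant2019Principalization : CossartPiltant2019Principalization.{0} := by
  sorry

/-- STUB (NAMED FACT, not research — verbatim the `Literature` named fact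
`Literature.AlgebraicGeometry.Resolution.CossartJannsenSaito2020_sigmaMaxElimination`; discharged
when its `_holds` theorem lands; no stub-worker). **Cossart–Jannsen–Saito 2020, Def. 6.15 /
Thm. 6.28 with Thm. 3.10 (1)**: every non-regular reduced excellent Noetherian scheme of dimension
`≤ 2` admits a `Σ^max`-elimination by a sequence of blow-ups with centres over the Hilbert–Samuel
locus. [cite: CossartJannsenSaito2020, Def. 6.15, Thm. 6.28, Thm. 3.10 (1)] -/
theorem stub_cossartJannsenSaito2020SigmaMaxElimination : CossartJannsenSaito2020_sigmaMaxElimination.{0} := by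
  sorry

/-- STUB (NAMED FACT, not research — verbatim the `Literature` named fact
`Literature.AlgebraicGeometry.Resolution.CossartJannsenSaito2020_corollary_6_18`; discharged when
its `_holds` theorem lands; no stub-worker). **Cossart–Jannsen–Saito 2020, Cor. 6.18 (`d = 2`)**:
the existence of `Σ^max`-eliminations implies that every reduced excellent Noetherian scheme of
dimension `≤ 2` carries a finite sequence of blow-ups with centres over `X ∖ Reg X` whose last
scheme is regular (termination Thm. 6.17). [cite: CossartJannsenSaito2020, Cor. 6.18, Thm. 6.17] -/
theorem stub_cossartJannsenSaito2020Corollary618 : CossartJannsenSaito2020_corollary_6_18.{0} := by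
  sorry

/-- STUB — THE KERNEL (the one research stub of the line after the reshape; Cossart–Piltant 2019,
"test case" `h = X^p + f` over a regular local ring of dimension `n ≥ 4`; Temkin 2013,
Rem. 1.3.5 (iii); open). **Temkin's local hypothesis at the singular points of local dimension
`≥ 4` of degree-`p` purely inseparable normalizations of regular varieties.** For `k` a field of
characteristic `p`, `W` a regular integral separated `k`-scheme of finite type, `L/K(W)` purely
inseparable of degree `p`, `x` a NON-regular point of `W^L = normalizationIn W L` with
`dim 𝒪_{W^L,x} ≥ 4`, and `g : S' → Spec 𝒪_{W^L,x}` a blow-up along an ideal sheaf `I` all of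
whose non-regular points lie over the closed point: `S'` admits a desingularization
(`Scheme.AdmitsDesingularization`: ONE blow-up along an ideal sheaf co-supported in `S' ∖ Reg S'`
with regular source). Implied by `ResolutionOver (Spec k)` for all fields `k` of characteristic
`p` (Temkin-strong resolution of varieties; `Theorems/PAlterationPicoverKernelHonesty.lean`). -/
theorem stub_picoverKernel : ∀ (p : ℕ), p.Prime → ∀ (k : Type) [Field k] [CharP k p] (W : Scheme.{0}) [IsIntegral W] (f : W ⟶ Spec (.of k)) (L : Type) [Field L] [Algebra W.functionField L], IsSeparated f → LocallyOfFiniteType f → QuasiCompact f → Scheme.IsRegular W → IsPurelyInseparable W.functionField L → Module.finrank W.functionField L = p → ∀ x : normalizationIn W L, x ∉ Scheme.regularLocus (normalizationIn W L) → 4 ≤ ringKrullDim ((normalizationIn W L).presheaf.stalk x) → ∀ (S' : Scheme.{0}) (g : S' ⟶ Spec ((normalizationIn W L).presheaf.stalk x)) (I : (Spec ((normalizationIn W L).presheaf.stalk x)).IdealSheafData), IsBlowup g I → (∀ s : S', s ∉ Scheme.regularLocus S' → g s = IsLocalRing.closedPoint ((normalizationIn W L).presheaf.stalk x)) → Scheme.AdmitsDesingularization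 S' := by
  sorry

/-- PROVED MODULO THE STUBS (was the registered residue `stub_picoverDegP`; reshaped 2026-08-17
through `KernelReduction.stub_picoverDegP_of_facts_and_kernel`, p133544). THE RESIDUE (research
content of the crux; Temkin 2013, Rem. 1.3.5 (ii)-(iii), the "inseparable case"; open from
dimension `4`, known in dimension `≤ 3` by Cossart–Piltant 2019). **Degree-`p` purely inseparable
normalizations of regular varieties have resolutions**: for `W` a regular integral separated
`k`-scheme of finite type (`char k = p`) and `L ⊇ K(W)` purely inseparable of degree `p` (so
`L = K(W)(f^{1/p})`, and `W^L` is locally the normalization of `t^p = f`), the normalization `W^L`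
of `W` in `L` has a resolution of singularities. Proof: Temkin's localisation of
desingularization in blow-up form for the ONE scheme `W^L` over the quasi-excellent base `Spec k`
(`LocalBlowups.admitsDesingularization_of_localBlowups`, Temkin 2008 Prop. 2.3.4); at a singular
point of local dimension `≤ 3` every blow-up of the local scheme is a separated threefold /
surface / curve of finite type over the excellent ring `𝒪_{W^L,x}` and is desingularized by
CP 2019 Thm. 1.1 + Prop. 4.4 + Raynaud–Gruson, resp. CJS 2020 Thm. 1.2
(`KernelReduction.localBlowups_of_ringKrullDim_le_three`); at local dimension `≥ 4` the kernel
`stub_picoverKernel` applies; a desingularization of an integral scheme is a resolution. -/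
theorem stub_picoverDegP : ∀ (p : ℕ), p.Prime → ∀ (k : Type) [Field k] [CharP k p] (W : Scheme.{0}) [IsIntegral W] (f : W ⟶ Spec (.of k)) (L : Type) [Field L] [Algebra W.functionField L], IsSeparated f → LocallyOfFiniteType f → QuasiCompact f → Scheme.IsRegular W → IsPurelyInseparable W.functionField L → Module.finrank W.functionField L = p → Scheme.HasResolution (normalizationIn W L) :=
  Summit.ResolutionOfSingularities.ResolutionOfSingularities.Theorems.Picover.KernelReduction.stub_picoverDegP_of_facts_and_kernel
    stub_cossartPiltant2019General stub_cossartPiltant2019Principalization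
    (fun X _ _ hexc hdim =>
      stub_cossartJannsenSaito2020Corollary618 stub_cossartJannsenSaito2020SigmaMaxElimination X
        hexc hdim)
    stub_picoverKernel

/-! ## Composition -/

/-- The function field of a scheme over a field of characteristic `p` has characteristic `p`.
[folklore] -/
theorem charP_functionField {p : ℕ} {k : Type} [Field k] [CharP k p] (Y : Scheme.{0})
    [IsIntegral Y] (f : Y ⟶ Spec (.of k)) : CharP Y.functionField p := by
  -- the composite ring map `k → Γ(Y, ⊤) → K(Y)` out of a field is injective
  haveI : Nonempty (⊤ : Y.Opens) := ⟨⟨genericPoint Y, trivial⟩⟩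
  let φ : k →+* Y.functionField :=
    (Y.germToFunctionField ⊤).hom.comp ((f.appTop).hom.comp (Scheme.ΓSpecIso (.of k)).inv.hom)
  exact (φ.charP_iff_charP p).mp inferInstance

/-- **Induction along the `p`-tower** (the heart of the composition): under the function-field
identification, the residue at `(p, k)` and the transport step, every finite purely inseparable
extension `L` of `K(Y)` of degree `p ^ n`, `Y` regular integral separated of finite type over
`k`, has `HasResolution (Y^L)`. [folklore] -/
theorem hasResolution_normalizationIn_of_finrank_eq_pow {p : ℕ} [Fact p.Prime] {k : Type}
    [Field k] [CharP k p]
    (hK0 : ∀ (W : Scheme.{0}) [IsIntegral W] (L : Type) [Field L] [Algebra W.functionField L]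
      [FiniteDimensional W.functionField L], ∃ e : (normalizationIn W L).functionField ≃+* L,
        e.toRingHom.comp (RatFn.functionFieldMap (normalizationInι W L)) =
          algebraMap W.functionField L)
    (hDegP : ∀ (W : Scheme.{0}) [IsIntegral W] (f : W ⟶ Spec (.of k)) (L : Type) [Field L]
      [Algebra W.functionField L], IsSeparated f → LocallyOfFiniteType f → QuasiCompact f →
        Scheme.IsRegular W → IsPurelyInseparable W.functionField L →
          Module.finrank W.functionField L = p → Scheme.HasResolution (normalizationIn W L))
    (Y : Scheme.{0}) [IsIntegral Y] (f : Y ⟶ Spec (.of k)) [IsSeparated f]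
    [LocallyOfFiniteType f] [QuasiCompact f] (hYreg : Scheme.IsRegular Y) :
    ∀ (n : ℕ) (L : Type) [Field L] [Algebra Y.functionField L]
      [FiniteDimensional Y.functionField L] [IsPurelyInseparable Y.functionField L],
      Module.finrank Y.functionField L = p ^ n → Scheme.HasResolution (normalizationIn Y L) := by
  intro n
  induction n with
  | zero =>
    intro L _ _ _ _ hdeg
    exact stub_baseCase Y L (hK0 Y L) hYreg (by simpa using hdeg)
  | succ n ih =>
    intro L _ _ _ _ hdeg
    haveI : CharP Y.functionField p := charP_functionField Y f
    have hp : (p : ℕ).Prime := Fact.out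
    -- an intermediate field `M` of index `p`
    have hne : Module.finrank Y.functionField L ≠ 1 := by
      rw [hdeg]
      exact (Nat.one_lt_pow (Nat.succ_ne_zero n) hp.one_lt).ne'
    obtain ⟨M, hM⟩ := stub_pTower p Y.functionField L hne
    -- `[M : K(Y)] = p ^ n` by the tower law
    have hMdeg : Module.finrank Y.functionField M = p ^ n := by
      have htower := Module.finrank_mul_finrank Y.functionField M L
      rw [hM, hdeg, pow_succ] at htower
      exact Nat.eq_of_mul_eq_mul_right hp.pos htower
    -- induction hypothesis for `M`, then the transport step
    have hMres : Scheme.HasResolution (normalizationIn Y M) := ih M hMdeg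
    exact stub_towerTransport p k hK0 hDegP Y f L M inferInstance hM hMres

/-- **The line closes the crux modulo its stubs**: `Picover` BY NAME. For `g : X → Y` as in the
crux, `g` is dominant (surjective), `K(X)/K(Y)` is finite (finite `g`) and purely inseparable
(`stub_functionFieldRadicial`), of degree `p ^ n` (`IsPurelyInseparable.finrank_eq_pow`); the tower
induction gives a resolution of `Y^{K(X)}`, and `stub_ofNormalizationIn` transfers it to `X`. -/
theorem Picover_of : Summit.ResolutionOfSingularities.ResolutionOfSingularities.Theses.PAlteration.Picover := by
  intro p hp k _ _ Y X f g hsep hlft hqc hY hYreg hX hfin hui hsurj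
  haveI : Fact p.Prime := ⟨hp⟩
  haveI : IsDominant g := ⟨hsurj.denseRange⟩
  haveI : CharP Y.functionField p := charP_functionField Y f
  haveI : ExpChar Y.functionField p := ExpChar.prime hp
  -- `K(X)/K(Y)` is finite purely inseparable of degree `p ^ n`
  haveI : IsPurelyInseparable Y.functionField (FunctionFieldOver g) :=
    stub_functionFieldRadicial X Y g
  obtain ⟨n, hn⟩ := IsPurelyInseparable.finrank_eq_pow Y.functionField (FunctionFieldOver g) p
  -- the tower induction resolves the normalization of `Y` in `K(X)` …
  have hN : Scheme.HasResolution (normalizationIn Y (FunctionFieldOver g)) :=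
    hasResolution_normalizationIn_of_finrank_eq_pow stub_functionField_normalizationIn
      (stub_picoverDegP p hp k) Y f hYreg n (FunctionFieldOver g) hn
  -- … and the finite birational comparison map transfers the resolution to `X`
  exact stub_ofNormalizationIn k X Y f g (stub_functionField_normalizationIn Y (FunctionFieldOver g)) hN

end Summit.ResolutionOfSingularities.ResolutionOfSingularities.Cruxes.Picover.DegreePTower

end
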